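import Summits.BirchSwinnertonDyer.BirchSwinnertonDyer.Theorems.RamifiedSevenEllipticUnitsLemmaXiDeuringAssembly
import Literature.NumberTheory.GaloisRepresentations.HeckeCharacterFiniteIdeleValuesProofs
import Literature.NumberTheory.GaloisRepresentations.HeckeCharacterWeakApproximation
import Literature.NumberTheory.Automorphic.BookerKrishnamurthyConverseProofs
import Literature.NumberTheory.Automorphic.QuadraticHeckeCharacterInfiniteIdeles
import Literature.NumberTheory.Automorphic.GaloisActionAdeleRing
import Literature.NumberTheory.EllipticCurves.HeegnerPoints
import Summits.BirchSwinnertonDyer.Rank1Residual.X11b.EmbeddingDatumPrime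
import HarnessLib

set_option linter.dupNamespace false
set_option autoImplicit false

/-!
# Rigidity bridge, algebraic end — part 1 (archimedean): the symmetric product `φ·(φ∘c)` and the
# Booker–Krishnamurthy parameter `ν = −1/2`

Helper file for the K7r Value crux `EllipticUnitValueSevenOfGZK` (stmt-BirchSwinnertonDyer-19945), line
`rubin-formula-zp` v4.2 (skeleton `bd085e9ecccbb7e3`), registered stub H_Rig⁰
`stub_pinnedCharacterRigiditySeven : ∀ W ∈ 𝒞₇, X12.O11.RamifiedCMPinnedCharacterRigidityAtZp W 7` («every
Hecke character L-pinned to the CM curve is the Deuring character `ψ` or `ψ ∘ c`»). Planner D169 (cell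
`bsd-cm`, 2026-08-27) PARTITIONED the rigidity programme: the ANALYTIC end «L-pinned ⇒ value pairs»
((R1) `…RigidityDirichlet`, (R2) `…RigidityCoefficients`, seat k7r-c2) and the ALGEBRAIC end (R3)+(R4)
«value pairs ⇒ `φ ∈ {ψ, ψ∘c}`» (this file and its sequel `…RigidityFromPairs`, seat k7r-c3).

CONTENT (imaginary quadratic `K`, unique infinite place `w₀`, `σ = w₀.embedding`):
* §1 (one infinite place: `X11b.subsingleton_infinitePlace_of_isImaginaryQuadratic`) the archimedean value of an ARBITRARY Hecke character with
  Booker–Krishnamurthy parameters `(ν, k)` at `w₀` on principal ideles,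
  `φ((x)_∞) = (|σx|²)^ν (σx/|σx|)^k` (`coe_apply_infiniteIdeles_eq_of_hasComplexParam`), and of a
  character of infinity type `(1,0)`, `ψ((x)_∞) = σ(x)⁻¹`; `c • (x)_∞ = (c x)_∞`.
* §2 `mul_galConj_eq_of_valuePairs`: the PAIR DISJUNCTION at almost all `w` — `(φ(ϖ_w), φ(ϖ_{cw}))`
  equals `(ψ(ϖ_w), ψ(ϖ_{cw}))` up to order — already gives `φ·(φ∘c) = ψ·(ψ∘c)` (GL(1) rigidity
  `ext_of_eventually_valueAtUniformizer_eq`), whence, evaluating at the `c`-fixed ideles `(2)_∞`, `(3)_∞`: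
  `ν = −1/2` (`archParam_eq_neg_half`; the irrationality of `log 2/log 3` enters as `2^a ≠ 3^b`).

HONEST FRAMING: kernel lemmas about Hecke characters; nothing about BSD is claimed; the crux 19945 stays
OPEN; no named fact is introduced.

References: Neukirch, *Algebraic Number Theory* VII §6 (6.9), (6.13); Cassels–Fröhlich VII §4 Prop. 4.1;
Booker–Krishnamurthy, Compositio 147 (2011) §1.1.
-/

noncomputable section

open scoped Classical ComplexConjugate Pointwise nonZeroDivisors
open Filter NumberField NumberField.InfinitePlace IsDedekindDomain
  Literature.NumberTheory.GaloisRepresentations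
  Literature.NumberTheory.GaloisRepresentations.HeckeCharacter
  Literature.NumberTheory.Automorphic
  Literature.NumberTheory.QuadraticForms
  Literature.NumberTheory.EllipticCurves
  Literature.NumberTheory.LFunctions

namespace Summit.BirchSwinnertonDyer.BirchSwinnertonDyer.Theorems.RamifiedSevenEllipticUnits

namespace Rigidity

variable {K : Type} [Field K] [NumberField K]

/-! ## §1 The archimedean values of Hecke characters of an imaginary quadratic field -/

/-- In an imaginary quadratic field the infinite part `(x)_∞` of a principal idele is the one-place
idele `⟨x⟩_{w₀}` at the unique infinite place `w₀`. [folklore] -/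
theorem infiniteIdeles_globalToInfiniteUnits_eq_single (hK : IsImaginaryQuadratic K)
    (w₀ : InfinitePlace K) (x : Kˣ) :
    infiniteIdeles K (globalToInfiniteUnits K x) =
      infiniteIdeleSingle w₀
        (ideleInfiniteComponent K w₀ (infiniteIdeles K (globalToInfiniteUnits K x))) := by
  haveI := Rank1Residual.X11b.subsingleton_infinitePlace_of_isImaginaryQuadratic hK
  conv_lhs => rw [infiniteIdeles_eq_prod_infiniteIdeleSingle (globalToInfiniteUnits K x),
    Fintype.prod_subsingleton _ w₀]

/-- The `w₀`-coordinate of `(x)_∞` under `ι_{w₀} : K_{w₀} → ℂ` is `σ(x)`, `σ = w₀.embedding`.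
[folklore] -/
theorem extensionEmbedding_ideleInfiniteComponent_globalToInfiniteUnits (w₀ : InfinitePlace K)
    (x : Kˣ) :
    InfinitePlace.Completion.extensionEmbedding w₀
        ((ideleInfiniteComponent K w₀ (infiniteIdeles K (globalToInfiniteUnits K x)) :
          (w₀.Completion)ˣ) : w₀.Completion) = w₀.embedding (x : K) := by
  rw [val_ideleInfiniteComponent, infiniteIdeles_fst, val_globalToInfiniteUnits,
    InfiniteAdeleRing.algebraMap_apply]
  exact InfinitePlace.Completion.extensionEmbedding_coe w₀ (WithAbs.toAbs w₀.1 (x : K))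

/-- **`φ((x)_∞) = (|σx|²)^ν · (σx/|σx|)^k`** for an ARBITRARY Hecke character `φ` of an imaginary
quadratic field with Booker–Krishnamurthy parameters `(ν, k)` at the infinite place `w₀`
(`σ = w₀.embedding`, `x ∈ Kˣ`). [cite: BookerKrishnamurthy2011, §1.1 (p. 672)] -/
theorem coe_apply_infiniteIdeles_eq_of_hasComplexParam (hK : IsImaginaryQuadratic K)
    (w₀ : InfinitePlace K) {φ : HeckeCharacter K} {ν : ℂ} {k : ℤ}
    (hφ : HasComplexParam (φ.archComponent w₀) ν k) (x : Kˣ) :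
    ((φ (infiniteIdeles K (globalToInfiniteUnits K x)) : ℂˣ) : ℂ) =
      (((‖w₀.embedding (x : K)‖ ^ 2 : ℝ) : ℂ) ^ ν) *
        (w₀.embedding (x : K) / (‖w₀.embedding (x : K)‖ : ℂ)) ^ k := by
  set y := ideleInfiniteComponent K w₀ (infiniteIdeles K (globalToInfiniteUnits K x)) with hy
  have hval : InfinitePlace.Completion.extensionEmbedding w₀ (y : w₀.Completion) = w₀.embedding (x : K) :=
    extensionEmbedding_ideleInfiniteComponent_globalToInfiniteUnits w₀ x
  have hnorm : ‖(y : w₀.Completion)‖ = ‖w₀.embedding (x : K)‖ := by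
    rw [← hval, (InfinitePlace.Completion.isometry_extensionEmbedding w₀).norm_map_of_map_zero (map_zero _)]
  rw [infiniteIdeles_globalToInfiniteUnits_eq_single hK w₀ x, ← hy,
    ← HeckeCharacter.archComponent_apply, hφ y, hval, hnorm]

/-- **`ψ((x)_∞) = σ(x)⁻¹`** for a Hecke character `ψ` of infinity type `(1, 0)` of an imaginary
quadratic field (`σ = w₀.embedding` the embedding of the unique infinite place).
[cite: NeukirchANT1999, Ch. VII §6 Prop. (6.9)] -/
theorem coe_apply_infiniteIdeles_eq_of_hasInfinityType_one_zero (hK : IsImaginaryQuadratic K)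
    (w₀ : InfinitePlace K) {ψ : HeckeCharacter K}
    (hψ : ψ.HasInfinityType (fun _ ↦ 1) (fun _ ↦ 0)) (x : Kˣ) :
    ((ψ (infiniteIdeles K (globalToInfiniteUnits K x)) : ℂˣ) : ℂ) = (w₀.embedding (x : K))⁻¹ := by
  haveI := Rank1Residual.X11b.subsingleton_infinitePlace_of_isImaginaryQuadratic hK
  haveI : IsTotallyComplex K := hK.2
  rw [hψ.apply_globalToInfiniteUnits_eq_of_isTotallyComplex x, Fintype.prod_subsingleton _ w₀]
  simp

/-- `c • (x)_∞ = (c x)_∞` for the infinite parts of principal ideles. [folklore] -/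
theorem smul_infiniteIdeles_globalToInfiniteUnits (c : K ≃ₐ[ℚ] K) (x : Kˣ) :
    c • infiniteIdeles K (globalToInfiniteUnits K x) =
      infiniteIdeles K (globalToInfiniteUnits K (Units.map (c : K →+* K).toMonoidHom x)) := by
  apply Units.ext
  rw [AdeleRing.coe_smul_units]
  change c • (((globalToInfiniteUnits K x : InfiniteAdeleRing K),
      (1 : FiniteAdeleRing (𝓞 K) K)) : AdeleRing (𝓞 K) K) =
    (((globalToInfiniteUnits K (Units.map (c : K →+* K).toMonoidHom x) : InfiniteAdeleRing K),
      (1 : FiniteAdeleRing (𝓞 K) K)) : AdeleRing (𝓞 K) K)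
  rw [AdeleRing.smul_mk, smul_one, val_globalToInfiniteUnits, val_globalToInfiniteUnits,
    InfiniteAdeleRing.smul_algebraMap]
  rfl

/-! ## §2 The symmetric product `φ·(φ∘c)` is determined by the pairs; the parameter `ν` -/

/-- **The pair disjunction determines the symmetric product**: if at almost every `w` the values
`(φ(ϖ_w), φ(ϖ_{c w}))` are `(ψ(ϖ_w), ψ(ϖ_{c w}))` up to order, then `φ · (φ ∘ c) = ψ · (ψ ∘ c)`
(GL(1) rigidity `ext_of_eventually_valueAtUniformizer_eq`).
[cite: CasselsFrohlichANT1967, Ch. VII §4 Prop. 4.1 (proof)] -/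
theorem mul_galConj_eq_of_valuePairs (c : K ≃ₐ[ℚ] K) {φ ψ : HeckeCharacter K}
    (hpair : ∀ᶠ w in cofinite,
      (φ.valueAtUniformizer w = ψ.valueAtUniformizer w ∧
          φ.valueAtUniformizer (c • w) = ψ.valueAtUniformizer (c • w)) ∨
        (φ.valueAtUniformizer w = ψ.valueAtUniformizer (c • w) ∧
          φ.valueAtUniformizer (c • w) = ψ.valueAtUniformizer w)) :
    φ * HeckeCharacter.galConj c φ = ψ * HeckeCharacter.galConj c ψ := by
  have hur : ∀ χ : HeckeCharacter K, ∀ᶠ w in cofinite, χ.IsUnramifiedAt (c • w) := fun χ ↦ by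
    have hfin : ((fun w : HeightOneSpectrum (𝓞 K) ↦ c • w) ⁻¹' χ.ramifiedPlaces).Finite :=
      (HeckeCharacter.finite_ramifiedPlaces_holds χ).preimage
        (fun _ _ _ _ h ↦ smul_left_cancel c h)
    refine Filter.eventually_cofinite.mpr (hfin.subset fun w hw ↦ ?_)
    exact hw
  apply HeckeCharacter.ext_of_eventually_valueAtUniformizer_eq
  filter_upwards [hpair, hur φ, hur ψ] with w hw hφw hψw
  rw [valueAtUniformizer_mul', valueAtUniformizer_mul',
    valueAtUniformizer_galConj_of_isUnramifiedAt c φ w hφw,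
    valueAtUniformizer_galConj_of_isUnramifiedAt c ψ w hψw]
  rcases hw with ⟨h1, h2⟩ | ⟨h1, h2⟩
  · rw [h1, h2]
  · rw [h1, h2, mul_comm]

/-- `2^a = 3^b` is impossible for `a ≥ 1` (parity). [folklore] -/
theorem two_pow_ne_three_pow {a b : ℕ} (ha : 0 < a) : (2 : ℕ) ^ a ≠ 3 ^ b := by
  intro h
  have h2 : 2 ∣ 3 ^ b := h ▸ dvd_pow_self 2 ha.ne'
  have := Nat.Prime.dvd_of_dvd_pow Nat.prime_two h2
  omega

/-- **The parameter `ν` of `φ` is `−1/2`.** If `φ · (φ ∘ c) = ψ · (ψ ∘ c)` with `ψ` of infinity type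
`(1, 0)` on an imaginary quadratic field and `φ` has complex parameters `(ν, k)`, then evaluating at
the (c-fixed) infinite ideles `(n)_∞`, `n = 2, 3`, gives `(n²)^{2ν} = n^{−2}`, whence `re ν = −1/2`
and, because `log 2 / log 3` is irrational (`2^a ≠ 3^b`), `im ν = 0`. [folklore] -/
theorem archParam_eq_neg_half (hK : IsImaginaryQuadratic K) (w₀ : InfinitePlace K) (c : K ≃ₐ[ℚ] K)
    {φ ψ : HeckeCharacter K} {ν : ℂ} {k : ℤ} (hφ : HasComplexParam (φ.archComponent w₀) ν k)
    (hψ : ψ.HasInfinityType (fun _ ↦ 1) (fun _ ↦ 0))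
    (heq : φ * HeckeCharacter.galConj c φ = ψ * HeckeCharacter.galConj c ψ) :
    ν = -1 / 2 := by
  -- evaluation at `(n)_∞` for a natural number `n ≥ 2`
  have key : ∀ n : ℕ, 2 ≤ n → ∃ m : ℤ,
      (Real.log n : ℂ) * (4 * ν + 2) = m * (2 * Real.pi * Complex.I) := by
    intro n hn
    have hn0 : (n : K) ≠ 0 := by exact_mod_cast (show n ≠ 0 by omega)
    have hnR : (0 : ℝ) < n := by exact_mod_cast (show 0 < n by omega)
    set x : Kˣ := Units.mk0 (n : K) hn0 with hx
    -- `c` fixes `n`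
    have hcx : Units.map (c : K →+* K).toMonoidHom x = x := Units.ext (by simp [hx])
    have h := congrArg (fun χ : HeckeCharacter K ↦
      ((χ (infiniteIdeles K (globalToInfiniteUnits K x)) : ℂˣ) : ℂ)) heq
    simp only [HeckeCharacter.mul_apply, Units.val_mul, HeckeCharacter.galConj_apply,
      smul_infiniteIdeles_globalToInfiniteUnits, hcx] at h
    rw [coe_apply_infiniteIdeles_eq_of_hasComplexParam hK w₀ hφ x,
      coe_apply_infiniteIdeles_eq_of_hasInfinityType_one_zero hK w₀ hψ x] at h
    have hσ : w₀.embedding (x : K) = (n : ℂ) := by simp [hx]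
    have hnC : (n : ℂ) ≠ 0 := by exact_mod_cast (show n ≠ 0 by omega)
    rw [hσ, Complex.norm_natCast, Complex.ofReal_natCast, div_self hnC, one_zpow, mul_one] at h
    -- `((n²)^ν)² = (n⁻¹)²` ⇒ `exp (log n · (4ν + 2)) = 1`
    have hlog : Complex.log (((n : ℝ) ^ 2 : ℝ) : ℂ) = (2 * Real.log n : ℝ) := by
      rw [← Complex.ofReal_log (by positivity), Real.log_pow]; norm_num
    have hcpow : (((n : ℝ) ^ 2 : ℝ) : ℂ) ^ ν = Complex.exp ((Real.log n : ℂ) * (2 * ν)) := by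
      rw [Complex.cpow_def_of_ne_zero (by exact_mod_cast (pow_ne_zero 2 hnR.ne')), hlog]
      push_cast; ring_nf
    have hninv : ((n : ℂ))⁻¹ = Complex.exp (-(Real.log n : ℂ)) := by
      rw [Complex.exp_neg, ← Complex.ofReal_exp, Real.exp_log hnR]; push_cast; ring
    rw [hcpow, hninv, ← Complex.exp_add, ← Complex.exp_add] at h
    have h1 : Complex.exp ((Real.log n : ℂ) * (4 * ν + 2)) = 1 := by
      rw [show (Real.log n : ℂ) * (4 * ν + 2) =
          ((Real.log n : ℂ) * (2 * ν) + (Real.log n : ℂ) * (2 * ν)) -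
            (-(Real.log n : ℂ) + -(Real.log n : ℂ)) by ring,
        Complex.exp_sub, h, div_self (Complex.exp_ne_zero _)]
    exact Complex.exp_eq_one_iff.mp h1
  obtain ⟨m₂, hm₂⟩ := key 2 le_rfl
  obtain ⟨m₃, hm₃⟩ := key 3 (by norm_num)
  have hl2 : 0 < Real.log 2 := Real.log_pos (by norm_num)
  have hl3 : 0 < Real.log 3 := Real.log_pos (by norm_num)
  -- real parts: `log n · (4 re ν + 2) = 0`
  have hRe : ∀ (r : ℝ) (m : ℤ), (r : ℂ) * (4 * ν + 2) = m * (2 * Real.pi * Complex.I) →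
      r * (4 * ν.re + 2) = 0 := fun r m e ↦ by
    have e' := congrArg Complex.re e
    rw [Complex.re_ofReal_mul] at e'
    simpa using e'
  have hIm : ∀ (r : ℝ) (m : ℤ), (r : ℂ) * (4 * ν + 2) = m * (2 * Real.pi * Complex.I) →
      r * (4 * ν.im) = m * (2 * Real.pi) := fun r m e ↦ by
    have e' := congrArg Complex.im e
    rw [Complex.im_ofReal_mul] at e'
    simpa using e'
  have hre : ν.re = -1 / 2 := by
    have e := hRe _ _ hm₂
    rcases mul_eq_zero.mp e with h | h
    · exact absurd h hl2.ne'
    · linarith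
  have him2 : Real.log 2 * (4 * ν.im) = m₂ * (2 * Real.pi) := hIm _ _ hm₂
  have him3 : Real.log 3 * (4 * ν.im) = m₃ * (2 * Real.pi) := hIm _ _ hm₃
  have him : ν.im = 0 := by
    by_contra hne
    have h4 : (4 : ℝ) * ν.im ≠ 0 := mul_ne_zero (by norm_num) hne
    have hm2ne : m₂ ≠ 0 := by
      rintro rfl
      rw [Int.cast_zero, zero_mul] at him2
      exact mul_ne_zero hl2.ne' h4 him2
    -- `m₃ log 2 = m₂ log 3`
    have hcross : (m₃ : ℝ) * Real.log 2 = m₂ * Real.log 3 := by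
      apply mul_left_cancel₀ h4
      have e1 : 4 * ν.im * ((m₃ : ℝ) * Real.log 2) = m₃ * (Real.log 2 * (4 * ν.im)) := by ring
      have e2 : 4 * ν.im * ((m₂ : ℝ) * Real.log 3) = m₂ * (Real.log 3 * (4 * ν.im)) := by ring
      rw [e1, e2, him2, him3]; ring
    have hm3ne : m₃ ≠ 0 := by
      rintro rfl
      rw [Int.cast_zero, zero_mul] at hcross
      exact mul_ne_zero (Int.cast_ne_zero.mpr hm2ne) hl3.ne' hcross.symm
    -- pass to natural exponents
    have habs : (m₃.natAbs : ℝ) * Real.log 2 = m₂.natAbs * Real.log 3 := by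
      have e := congrArg abs hcross
      rw [abs_mul, abs_mul, abs_of_pos hl2, abs_of_pos hl3, ← Int.cast_abs, ← Int.cast_abs,
        ← Int.natCast_natAbs, ← Int.natCast_natAbs, Int.cast_natCast, Int.cast_natCast] at e
      exact e
    have hpow : ((2 : ℕ) : ℝ) ^ m₃.natAbs = ((3 : ℕ) : ℝ) ^ m₂.natAbs := by
      apply Real.log_injOn_pos (Set.mem_Ioi.mpr (by positivity)) (Set.mem_Ioi.mpr (by positivity))
      rw [Real.log_pow, Real.log_pow]
      exact_mod_cast habs
    have hnat : (2 : ℕ) ^ m₃.natAbs = 3 ^ m₂.natAbs := by exact_mod_cast hpow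
    exact two_pow_ne_three_pow (Int.natAbs_pos.mpr hm3ne) hnat
  apply Complex.ext <;> norm_num [hre, him]

end Rigidity

end Summit.BirchSwinnertonDyer.BirchSwinnertonDyer.Theorems.RamifiedSevenEllipticUnits

end
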